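import Mathlib
import HarnessLib
import Summits.RiemannHypothesis.RiemannHypothesis.Theorems.IntegerScrewTaylor3
import Summits.RiemannHypothesis.RiemannHypothesis.Theorems.IntegerScrewTailCalc

/-!
# Tail of the top-block pairing inequality — the third-order Taylor cell step

Support file for the kernel import of `TopBlockPairingNeg 31` (column SCREW, engine A).  With the
within-edge combinations kept exact (`h‴ = Ψ′·(3u″ + N u‴) + 3Ψ″·u′·(u′ + N u″) + N·Ψ‴·u′³`), the gross
bound `|h‴_e(N)| ≤ edgeH3Bound a b N₁ N₂ L` holds on a cell `[N₁, N₂]` (`abs_edgeH3_le`); summing over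
the edge list (`dsum`, `abs_dsum_le`) and applying the one-sided third-order Taylor bounds of
`IntegerScrewTaylor3` gives the cell inequality `dsum_taylor_bound`:
`D(N) ≤ D(N_c) + |D′(N_c)|·Δ + max(D″(N_c), 0)·Δ²/2 + B·Δ³/6`.  Nothing here bears on the truth of RH.
-/

set_option autoImplicit false
set_option linter.dupNamespace false

noncomputable section

open scoped Topology
open Real Filter Set

namespace Summit.RiemannHypothesis.RiemannHypothesis.Theorems.IntegerScrew

open Literature.NumberTheory.LFunctions

/-! ## Gross bound of `h‴` on a cell `[N₁, N₂]` -/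
section EdgeBound

variable {a b : ℕ} {N N1 N2 : ℝ}

/-- The rational gross bound of `|h‴_e|` on `[N₁, N₂]` given a bound `L ≥ log((N₂ − a)/ℓ)`:
`(L/2+3)·3ℓ(ℓ+2a)N₂²/(N₁−b)⁶ + 3((N₂−a)/(2ℓ)+4)·(ℓ/((N₁−a)(N₁−b)))·(2ℓN₂²/(N₁−b)⁴) + N₂((N₂−a)²/ℓ²+1)·(ℓ/((N₁−a)(N₁−b)))³`. [folklore] -/
def edgeH3Bound (a b : ℕ) (N1 N2 L : ℝ) : ℝ :=
  (L / 2 + 3) * (3 * (b - a : ℝ) * ((b - a : ℝ) + 2 * a) * N2 ^ 2 / (N1 - b) ^ 6)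
    + 3 * ((N2 - a) / (2 * (b - a : ℝ)) + 4) * ((b - a : ℝ) / ((N1 - a) * (N1 - b)))
        * (2 * (b - a : ℝ) * N2 ^ 2 / (N1 - b) ^ 4)
    + N2 * (((N2 - a) / (b - a : ℝ)) ^ 2 + 1) * ((b - a : ℝ) / ((N1 - a) * (N1 - b))) ^ 3

/-- `h‴ = Ψ′·(3u₂ + N u₃) + 3Ψ″·u₁·(u₁ + N u₂) + N·Ψ‴·u₁³` (regrouping). [folklore] -/
theorem edgeH3_eq_grouped (a b : ℕ) (N : ℝ) :
    edgeH3 a b N = zetaScrewDeriv (edgeU a b N) * (3 * edgeU2 a b N + N * edgeU3 a b N)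
      + 3 * zetaScrewDeriv2 (edgeU a b N) * edgeU1 a b N * (edgeU1 a b N + N * edgeU2 a b N)
      + N * zetaScrewDeriv3 (edgeU a b N) * edgeU1 a b N ^ 3 := by
  unfold edgeH3; ring

/-- Elementary bounds on `u`: `ℓ/(N − a) ≤ u ≤ ℓ/(N − b)` (`ℓ = b − a`, `N > b`). [folklore] -/
theorem edgeU_bounds (hab : a < b) (hN : (b : ℝ) < N) :
    ((b : ℝ) - a) / (N - a) ≤ edgeU a b N ∧ edgeU a b N ≤ ((b : ℝ) - a) / (N - b) := by
  have hab' : (a : ℝ) < b := by exact_mod_cast hab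
  have ha : (0 : ℝ) < N - a := by linarith
  have hb : (0 : ℝ) < N - b := by linarith
  have hq : edgeU a b N = Real.log ((N - a) / (N - b)) := by
    unfold edgeU; rw [Real.log_div ha.ne' hb.ne']
  rw [hq]
  have hx : 0 < (N - a) / (N - b) := div_pos ha hb
  constructor
  · -- log x ≥ 1 − 1/x
    have h := Real.one_sub_inv_le_log_of_pos hx
    have : 1 - ((N - a) / (N - b))⁻¹ = ((b : ℝ) - a) / (N - a) := by
      field_simp; ring
    linarith [this ▸ h]
  · -- log x ≤ x − 1
    have h := Real.log_le_sub_one_of_pos hx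
    have : (N - a) / (N - b) - 1 = ((b : ℝ) - a) / (N - b) := by
      field_simp; ring
    linarith [this ▸ h]

/-- `|3u₂ + N u₃| ≤ 3ℓ(ℓ+2a)N₂²/(N₁−b)⁶` on `[N₁, N₂]` (`b < N₁`). [folklore] -/
theorem abs_comb3_le (hab : a < b) (hN1 : (b : ℝ) < N1) (h1 : N1 ≤ N) (h2 : N ≤ N2) :
    |3 * edgeU2 a b N + N * edgeU3 a b N|
      ≤ 3 * ((b : ℝ) - a) * (((b : ℝ) - a) + 2 * a) * N2 ^ 2 / (N1 - b) ^ 6 := by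
  have hab' : (a : ℝ) < b := by exact_mod_cast hab
  set p := N - a with hp
  set q := N - b with hq
  set l := (b : ℝ) - a with hl
  have hq0 : 0 < q := by rw [hq]; linarith
  have hp0 : 0 < p := by rw [hp]; linarith
  have hpq : p = q + l := by rw [hp, hq, hl]; ring
  have ha0 : (0 : ℝ) ≤ a := Nat.cast_nonneg a
  -- exact expression: 3u₂ + N u₃ = −l (p l (2p+q) + 2a(p²+pq+q²)) / (p³ q³)
  have hid : 3 * edgeU2 a b N + N * edgeU3 a b N
      = -(l * (p * l * (2 * p + q) + 2 * a * (p ^ 2 + p * q + q ^ 2))) / (p ^ 3 * q ^ 3) := by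
    have hNp : N = p + a := by rw [hp]; ring
    unfold edgeU2 edgeU3
    rw [← hp, ← hq]
    rw [hNp]
    field_simp
    rw [hpq]
    ring
  rw [hid, abs_div, abs_neg, abs_of_nonneg (by positivity), abs_of_nonneg (by positivity)]
  -- numerator ≤ 3 l (l + 2a) N2², denominator ≥ (N1 − b)⁶
  have hpN : p ≤ N2 := by rw [hp]; linarith
  have hqN : q ≤ N2 := by rw [hq]; linarith
  have hl0 : 0 < l := by rw [hl]; linarith
  have hN2 : 0 < N2 := by linarith
  have hnum : l * (p * l * (2 * p + q) + 2 * a * (p ^ 2 + p * q + q ^ 2))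
      ≤ 3 * l * (l + 2 * a) * N2 ^ 2 := by
    have e0 : p * (2 * p + q) ≤ 3 * N2 ^ 2 := by nlinarith
    have e1 : p * l * (2 * p + q) ≤ l * (3 * N2 ^ 2) := by
      have := mul_le_mul_of_nonneg_left e0 hl0.le
      nlinarith [this]
    have e2 : 2 * a * (p ^ 2 + p * q + q ^ 2) ≤ 2 * a * (3 * N2 ^ 2) := by
      apply mul_le_mul_of_nonneg_left _ (by positivity); nlinarith
    nlinarith
  have hden : (N1 - b) ^ 6 ≤ p ^ 3 * q ^ 3 := by
    have hq1 : N1 - b ≤ q := by rw [hq]; linarith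
    have hp1 : N1 - b ≤ p := by rw [hp]; linarith
    have h0 : 0 ≤ N1 - b := by linarith
    have := mul_le_mul (pow_le_pow_left₀ h0 hp1 3) (pow_le_pow_left₀ h0 hq1 3) (by positivity) (by positivity)
    calc (N1 - b) ^ 6 = (N1 - b) ^ 3 * (N1 - b) ^ 3 := by ring
      _ ≤ p ^ 3 * q ^ 3 := this
  have hNb : 0 < N1 - b := by linarith
  have hden0 : 0 < (N1 - b) ^ 6 := by positivity
  exact div_le_div₀ (by positivity) hnum hden0 hden

/-- `|u₁| ≤ ℓ/((N₁−a)(N₁−b))` on `[N₁, ∞)`. [folklore] -/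
theorem abs_edgeU1_le (hab : a < b) (hN1 : (b : ℝ) < N1) (h1 : N1 ≤ N) :
    |edgeU1 a b N| ≤ ((b : ℝ) - a) / ((N1 - a) * (N1 - b)) := by
  have hab' : (a : ℝ) < b := by exact_mod_cast hab
  have ha : 0 < N - a := by linarith
  have hb : 0 < N - b := by linarith
  have hid : edgeU1 a b N = -(((b : ℝ) - a) / ((N - a) * (N - b))) := by
    unfold edgeU1; field_simp; ring
  rw [hid, abs_neg, abs_of_nonneg (by positivity)]
  have h0 : 0 < N1 - b := by linarith
  have h0' : 0 < N1 - a := by linarith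
  apply div_le_div₀ (by linarith) le_rfl (by positivity)
  exact mul_le_mul (by linarith) (by linarith) h0.le ha.le

/-- `|u₁ + N u₂| ≤ 2ℓN₂²/(N₁−b)⁴` on `[N₁, N₂]`. [folklore] -/
theorem abs_comb2_le (hab : a < b) (hN1 : (b : ℝ) < N1) (h1 : N1 ≤ N) (h2 : N ≤ N2) :
    |edgeU1 a b N + N * edgeU2 a b N| ≤ 2 * ((b : ℝ) - a) * N2 ^ 2 / (N1 - b) ^ 4 := by
  have hab' : (a : ℝ) < b := by exact_mod_cast hab
  set p := N - a with hp
  set q := N - b with hq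
  set l := (b : ℝ) - a with hl
  have hq0 : 0 < q := by rw [hq]; linarith
  have hp0 : 0 < p := by rw [hp]; linarith
  have hpq : p = q + l := by rw [hp, hq, hl]; ring
  have hid : edgeU1 a b N + N * edgeU2 a b N = l * (N * (p + q) - p * q) / (p ^ 2 * q ^ 2) := by
    unfold edgeU1 edgeU2
    rw [← hp, ← hq]
    field_simp
    rw [hpq]; ring
  rw [hid, abs_div, abs_of_nonneg (by positivity : (0:ℝ) ≤ p ^ 2 * q ^ 2)]
  have hl0 : 0 < l := by rw [hl]; linarith
  have hN0 : 0 < N := by linarith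
  have hpN : p ≤ N2 := by rw [hp]; linarith [(Nat.cast_nonneg a : (0:ℝ) ≤ a)]
  have hqN : q ≤ N2 := by rw [hq]; linarith [(Nat.cast_nonneg b : (0:ℝ) ≤ b)]
  have hnum : |l * (N * (p + q) - p * q)| ≤ 2 * l * N2 ^ 2 := by
    have hN2' : N ≤ N2 := h2
    have up : N * (p + q) ≤ 2 * N2 ^ 2 := by nlinarith
    have lo : p * q ≤ N2 ^ 2 := by nlinarith
    have hin : -(2 * N2 ^ 2) ≤ N * (p + q) - p * q ∧ N * (p + q) - p * q ≤ 2 * N2 ^ 2 := by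
      constructor <;> nlinarith [mul_pos hp0 hq0, mul_pos hN0 hp0, mul_pos hN0 hq0]
    rw [abs_le]
    constructor
    · nlinarith [mul_le_mul_of_nonneg_left hin.1 hl0.le]
    · nlinarith [mul_le_mul_of_nonneg_left hin.2 hl0.le]
  have hden : (N1 - b) ^ 4 ≤ p ^ 2 * q ^ 2 := by
    have hq1 : N1 - b ≤ q := by rw [hq]; linarith
    have hp1 : N1 - b ≤ p := by rw [hp]; linarith
    have h0 : 0 ≤ N1 - b := by linarith
    have := mul_le_mul (pow_le_pow_left₀ h0 hp1 2) (pow_le_pow_left₀ h0 hq1 2) (by positivity) (by positivity)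
    calc (N1 - b) ^ 4 = (N1 - b) ^ 2 * (N1 - b) ^ 2 := by ring
      _ ≤ p ^ 2 * q ^ 2 := this
  have hNb : 0 < N1 - b := by linarith
  have hden0 : 0 < (N1 - b) ^ 4 := by positivity
  exact div_le_div₀ (by positivity) hnum hden0 hden

end EdgeBound

/-! ## `|h‴| ≤ edgeH3Bound` on a cell -/
section EdgeH3

variable {a b : ℕ} {N N1 N2 : ℝ}

/-- **Gross bound of the third derivative of an edge term on a cell.**  For `a < b`, `N₁ > 2b − a`,
`ℓ/(N₁ − b) ≤ 1/2`, `N ∈ [N₁, N₂]` and `L ≥ log((N₂ − a)/ℓ)`: `|h‴_e(N)| ≤ edgeH3Bound a b N₁ N₂ L`. [folklore] -/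
theorem abs_edgeH3_le (hab : a < b) (hN1 : (2 * b : ℝ) - a < N1) (hu : ((b : ℝ) - a) / (N1 - b) ≤ 1 / 2)
    (h1 : N1 ≤ N) (h2 : N ≤ N2) {L : ℝ} (hL : Real.log ((N2 - a) / ((b : ℝ) - a)) ≤ L) :
    |edgeH3 a b N| ≤ edgeH3Bound a b N1 N2 L := by
  have hab' : (a : ℝ) < b := by exact_mod_cast hab
  have ha0 : (0 : ℝ) ≤ a := Nat.cast_nonneg a
  have hbN1 : (b : ℝ) < N1 := by linarith
  have hbN : (b : ℝ) < N := by linarith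
  have hN : (2 * b : ℝ) - a < N := by linarith
  set l := (b : ℝ) - a with hl
  have hl0 : 0 < l := by rw [hl]; linarith
  set u := edgeU a b N with hu'
  obtain ⟨hu0, _⟩ := edgeU_pos_lt hab hN
  obtain ⟨ulo, uhi⟩ := edgeU_bounds hab hbN
  rw [← hu'] at hu0 ulo uhi
  -- u ≤ 1/2 and 1/u ≤ (N2 - a)/l
  have hNa : 0 < N - a := by linarith
  have hN1b : 0 < N1 - b := by linarith
  have hu_half : u ≤ 1 / 2 := by
    have : l / (N - b) ≤ l / (N1 - b) := by
      apply div_le_div_of_nonneg_left hl0.le hN1b; linarith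
    linarith
  have hinv : 1 / u ≤ (N2 - a) / l := by
    rw [div_le_div_iff₀ hu0 hl0]
    have : l ≤ u * (N - a) := by
      have := ulo; rw [div_le_iff₀ hNa] at this; linarith
    nlinarith
  have hinv0 : 0 < (N2 - a) / l := lt_of_lt_of_le (by positivity) hinv
  have hlog : Real.log (1 / u) ≤ L := by
    have : Real.log (1 / u) ≤ Real.log ((N2 - a) / l) := Real.log_le_log (by positivity) hinv
    linarith
  -- the three Ψ-factors
  have hP1 : |zetaScrewDeriv u| ≤ L / 2 + 3 := by
    have := abs_zetaScrewDeriv_le hu0 hu_half; linarith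
  have hP2 : |zetaScrewDeriv2 u| ≤ (N2 - a) / (2 * l) + 4 := by
    have h := abs_zetaScrewDeriv2_le hu0 (by linarith)
    have : 1 / (2 * u) ≤ (N2 - a) / (2 * l) := by
      have := hinv
      rw [div_le_div_iff₀ (by positivity) (by positivity)]
      rw [div_le_div_iff₀ hu0 hl0] at this
      linarith
    linarith
  have hP3 : |zetaScrewDeriv3 u| ≤ ((N2 - a) / l) ^ 2 + 1 := by
    have h := abs_zetaScrewDeriv3_le hu0 hu_half
    have : 1 / u ^ 2 ≤ ((N2 - a) / l) ^ 2 := by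
      have e : 1 / u ^ 2 = (1 / u) ^ 2 := by rw [one_div_pow]
      rw [e]; exact pow_le_pow_left₀ (by positivity) hinv 2
    linarith
  -- the three u-combinations
  have hC3 := abs_comb3_le (N := N) hab hbN1 h1 h2
  have hC1 := abs_edgeU1_le (N := N) hab hbN1 h1
  have hC2 := abs_comb2_le (N := N) hab hbN1 h1 h2
  have hNabs : |N| ≤ N2 := by rw [abs_of_pos (by linarith)]; exact h2
  -- assemble
  rw [edgeH3_eq_grouped]
  have T1 : |zetaScrewDeriv u * (3 * edgeU2 a b N + N * edgeU3 a b N)|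
      ≤ (L / 2 + 3) * (3 * l * (l + 2 * a) * N2 ^ 2 / (N1 - b) ^ 6) := by
    rw [abs_mul]; exact mul_le_mul hP1 hC3 (abs_nonneg _) (by linarith [abs_nonneg (zetaScrewDeriv u)])
  have T2 : |3 * zetaScrewDeriv2 u * edgeU1 a b N * (edgeU1 a b N + N * edgeU2 a b N)|
      ≤ 3 * ((N2 - a) / (2 * l) + 4) * (l / ((N1 - a) * (N1 - b))) * (2 * l * N2 ^ 2 / (N1 - b) ^ 4) := by
    rw [abs_mul, abs_mul, abs_mul, abs_of_pos (by norm_num : (0:ℝ) < 3)]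
    have s1 : 3 * |zetaScrewDeriv2 u| ≤ 3 * ((N2 - a) / (2 * l) + 4) := by linarith
    have n1 : 0 ≤ 3 * ((N2 - a) / (2 * l) + 4) := by linarith [abs_nonneg (zetaScrewDeriv2 u)]
    have n2 : 0 ≤ l / ((N1 - a) * (N1 - b)) := le_trans (abs_nonneg _) hC1
    have s2 := mul_le_mul s1 hC1 (abs_nonneg _) n1
    exact mul_le_mul s2 hC2 (abs_nonneg _) (mul_nonneg n1 n2)
  have T3 : |N * zetaScrewDeriv3 u * edgeU1 a b N ^ 3| ≤ N2 * (((N2 - a) / l) ^ 2 + 1) * (l / ((N1 - a) * (N1 - b))) ^ 3 := by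
    rw [abs_mul, abs_mul, abs_pow]
    have s1 := mul_le_mul hNabs hP3 (abs_nonneg _) (by linarith)
    have s3 : |edgeU1 a b N| ^ 3 ≤ (l / ((N1 - a) * (N1 - b))) ^ 3 := pow_le_pow_left₀ (abs_nonneg _) hC1 3
    have n3 : 0 ≤ N2 * (((N2 - a) / l) ^ 2 + 1) := le_trans (by positivity) s1
    exact mul_le_mul s1 s3 (by positivity) n3
  have tri := abs_add_three (zetaScrewDeriv u * (3 * edgeU2 a b N + N * edgeU3 a b N))
    (3 * zetaScrewDeriv2 u * edgeU1 a b N * (edgeU1 a b N + N * edgeU2 a b N))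
    (N * zetaScrewDeriv3 u * edgeU1 a b N ^ 3)
  unfold edgeH3Bound
  rw [← hl]
  linarith

end EdgeH3

/-! ## The design sums `D, D′, D″, D‴` over the edge list and the Taylor step -/
section DSum

/-- Weighted sum of an edge functional over an edge list `(a, b, k)`. [folklore] -/
noncomputable def dsum (f : ℕ → ℕ → ℝ → ℝ) (L : List (ℕ × ℕ × ℤ)) (N : ℝ) : ℝ :=
  (L.map fun t => (t.2.2 : ℝ) * f t.1 t.2.1 N).sum

/-- The empty design sum. [folklore] -/
theorem dsum_nil (f : ℕ → ℕ → ℝ → ℝ) (N : ℝ) : dsum f [] N = 0 := by simp [dsum]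

/-- One edge peeled off a design sum. [folklore] -/
theorem dsum_cons (f : ℕ → ℕ → ℝ → ℝ) (t : ℕ × ℕ × ℤ) (L : List (ℕ × ℕ × ℤ)) (N : ℝ) :
    dsum f (t :: L) N = (t.2.2 : ℝ) * f t.1 t.2.1 N + dsum f L N := by simp [dsum]

/-- Termwise differentiation of the design sums (`N > 30`). [folklore] -/
theorem hasDerivAt_dsum {f f' : ℕ → ℕ → ℝ → ℝ}
    (hf : ∀ a b : ℕ, a < b → ∀ N : ℝ, (2 * b : ℝ) - a < N → HasDerivAt (f a b) (f' a b N) N) :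
    ∀ L : List (ℕ × ℕ × ℤ), (∀ t ∈ L, t.1 < t.2.1 ∧ 2 * t.2.1 ≤ 30 + t.1) → ∀ {N : ℝ}, 30 < N → HasDerivAt (dsum f L) (dsum f' L N) N
  | [], _, N, _ => by
      simp only [dsum, List.map_nil, List.sum_nil]
      exact hasDerivAt_const N 0
  | t :: L, hL, N, hN => by
      have ht := hL t (by simp)
      have hrest := hasDerivAt_dsum hf L (fun s hs => hL s (by simp [hs])) hN
      have hcast : (2 * t.2.1 : ℝ) - t.1 < N := by
        have : (2 * t.2.1 : ℝ) ≤ 30 + t.1 := by exact_mod_cast ht.2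
        linarith
      have h1 := ((hf t.1 t.2.1 ht.1 N hcast).const_mul (t.2.2 : ℝ)).add hrest
      refine h1.congr_of_eventuallyEq (Filter.Eventually.of_forall fun y => ?_)
      simp [dsum]

/-- Gross bound of a design sum from per-edge bounds. [folklore] -/
theorem abs_dsum_le {f : ℕ → ℕ → ℝ → ℝ} {B : ℕ → ℕ → ℝ} {N : ℝ} :
    ∀ L : List (ℕ × ℕ × ℤ), (∀ t ∈ L, |f t.1 t.2.1 N| ≤ B t.1 t.2.1) →
      |dsum f L N| ≤ (L.map fun t => |(t.2.2 : ℝ)| * B t.1 t.2.1).sum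
  | [], _ => by simp [dsum]
  | t :: L, hL => by
      rw [dsum_cons]
      simp only [List.map_cons, List.sum_cons]
      have ht := hL t (by simp)
      have hrest := abs_dsum_le L (fun s hs => hL s (by simp [hs]))
      have h1 : |(t.2.2 : ℝ) * f t.1 t.2.1 N| ≤ |(t.2.2 : ℝ)| * B t.1 t.2.1 := by
        rw [abs_mul]; exact mul_le_mul_of_nonneg_left ht (abs_nonneg _)
      exact (abs_add_le _ _).trans (add_le_add h1 hrest)

/-- **The third-order Taylor step for the design sum** on a cell `[N₁, N₂]` with centre `N_c`
(`30 < N₁`): from a bound `B` on `|D‴|` over the cell,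
`D(N) ≤ D(N_c) + |D′(N_c)|·Δ + max(D″(N_c),0)·Δ²/2 + B·Δ³/6` with `Δ = max(N₂ − N_c, N_c − N₁)`. [folklore] -/
theorem dsum_taylor_bound {L : List (ℕ × ℕ × ℤ)} (hL : ∀ t ∈ L, t.1 < t.2.1 ∧ 2 * t.2.1 ≤ 30 + t.1) {N1 Nc N2 B Δ : ℝ}
    (h30 : 30 < N1) (hc1 : N1 ≤ Nc) (hc2 : Nc ≤ N2) (hΔ1 : N2 - Nc ≤ Δ) (hΔ2 : Nc - N1 ≤ Δ)
    (hB : ∀ N ∈ Set.Icc N1 N2, |dsum edgeH3 L N| ≤ B) {N : ℝ} (hN : N ∈ Set.Icc N1 N2) :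
    dsum edgeH L N ≤ dsum edgeH L Nc + |dsum edgeH1 L Nc| * Δ
      + max (dsum edgeH2 L Nc) 0 * Δ ^ 2 / 2 + B * Δ ^ 3 / 6 := by
  have hD : ∀ M, N1 ≤ M → HasDerivAt (dsum edgeH L) (dsum edgeH1 L M) M := fun M hM =>
    hasDerivAt_dsum (fun a b hab N hN => hasDerivAt_edgeH hab hN) L hL (by linarith)
  have hD1 : ∀ M, N1 ≤ M → HasDerivAt (dsum edgeH1 L) (dsum edgeH2 L M) M := fun M hM =>
    hasDerivAt_dsum (fun a b hab N hN => hasDerivAt_edgeH1 hab hN) L hL (by linarith)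
  have hD2 : ∀ M, N1 ≤ M → HasDerivAt (dsum edgeH2 L) (dsum edgeH3 L M) M := fun M hM =>
    hasDerivAt_dsum (fun a b hab N hN => hasDerivAt_edgeH2 hab hN) L hL (by linarith)
  have hΔ0 : 0 ≤ Δ := by linarith
  have hB0 : 0 ≤ B := le_trans (abs_nonneg _) (hB Nc ⟨hc1, hc2⟩)
  rcases le_total Nc N with hge | hle
  · -- right of the centre
    have key := taylor3_upper_right (f := dsum edgeH L) (f' := dsum edgeH1 L) (f'' := dsum edgeH2 L)
      (f''' := dsum edgeH3 L) (c := Nc) (b := N2) (B := B) hc2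
      (fun x hx => hD x (by linarith [hx.1])) (fun x hx => hD1 x (by linarith [hx.1]))
      (fun x hx => hD2 x (by linarith [hx.1]))
      (fun x hx => (abs_le.1 (hB x ⟨by linarith [hx.1], hx.2⟩)).2) (x := N) ⟨hge, hN.2⟩
    have hx : 0 ≤ N - Nc := by linarith
    have hxΔ : N - Nc ≤ Δ := by linarith [hN.2]
    have e1 : dsum edgeH1 L Nc * (N - Nc) ≤ |dsum edgeH1 L Nc| * Δ :=
      (le_abs_self _).trans (by rw [abs_mul, abs_of_nonneg hx]; exact mul_le_mul_of_nonneg_left hxΔ (abs_nonneg _))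
    have e2 : dsum edgeH2 L Nc * (N - Nc) ^ 2 / 2 ≤ max (dsum edgeH2 L Nc) 0 * Δ ^ 2 / 2 := by
      have : dsum edgeH2 L Nc * (N - Nc) ^ 2 ≤ max (dsum edgeH2 L Nc) 0 * Δ ^ 2 := by
        have h1 : dsum edgeH2 L Nc * (N - Nc) ^ 2 ≤ max (dsum edgeH2 L Nc) 0 * (N - Nc) ^ 2 :=
          mul_le_mul_of_nonneg_right (le_max_left _ _) (by positivity)
        have h2 : max (dsum edgeH2 L Nc) 0 * (N - Nc) ^ 2 ≤ max (dsum edgeH2 L Nc) 0 * Δ ^ 2 :=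
          mul_le_mul_of_nonneg_left (pow_le_pow_left₀ hx hxΔ 2) (le_max_right _ _)
        linarith
      linarith
    have e3 : B * (N - Nc) ^ 3 / 6 ≤ B * Δ ^ 3 / 6 := by
      have := mul_le_mul_of_nonneg_left (pow_le_pow_left₀ hx hxΔ 3) hB0
      linarith
    linarith
  · -- left of the centre
    have key := taylor3_upper_left (f := dsum edgeH L) (f' := dsum edgeH1 L) (f'' := dsum edgeH2 L)
      (f''' := dsum edgeH3 L) (a := N1) (c := Nc) (B := B) hc1
      (fun x hx => hD x hx.1) (fun x hx => hD1 x hx.1) (fun x hx => hD2 x hx.1)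
      (fun x hx => (abs_le.1 (hB x ⟨hx.1, by linarith [hx.2]⟩)).1) (x := N) ⟨hN.1, hle⟩
    have hx : 0 ≤ Nc - N := by linarith
    have hxΔ : Nc - N ≤ Δ := by linarith [hN.1]
    have e1 : dsum edgeH1 L Nc * (N - Nc) ≤ |dsum edgeH1 L Nc| * Δ := by
      have : dsum edgeH1 L Nc * (N - Nc) = -(dsum edgeH1 L Nc) * (Nc - N) := by ring
      rw [this]
      exact (le_abs_self _).trans (by rw [abs_mul, abs_neg, abs_of_nonneg hx]; exact mul_le_mul_of_nonneg_left hxΔ (abs_nonneg _))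
    have e2 : dsum edgeH2 L Nc * (N - Nc) ^ 2 / 2 ≤ max (dsum edgeH2 L Nc) 0 * Δ ^ 2 / 2 := by
      have hsq : (N - Nc) ^ 2 = (Nc - N) ^ 2 := by ring
      rw [hsq]
      have h1 : dsum edgeH2 L Nc * (Nc - N) ^ 2 ≤ max (dsum edgeH2 L Nc) 0 * (Nc - N) ^ 2 :=
        mul_le_mul_of_nonneg_right (le_max_left _ _) (by positivity)
      have h2 : max (dsum edgeH2 L Nc) 0 * (Nc - N) ^ 2 ≤ max (dsum edgeH2 L Nc) 0 * Δ ^ 2 :=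
        mul_le_mul_of_nonneg_left (pow_le_pow_left₀ hx hxΔ 2) (le_max_right _ _)
      linarith
    have e3 : B * (Nc - N) ^ 3 / 6 ≤ B * Δ ^ 3 / 6 := by
      have := mul_le_mul_of_nonneg_left (pow_le_pow_left₀ hx hxΔ 3) hB0
      linarith
    linarith

end DSum

end Summit.RiemannHypothesis.RiemannHypothesis.Theorems.IntegerScrew

end
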